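import Mathlib
import Summits.BirchSwinnertonDyer.BirchSwinnertonDyer.Theorems.KatoDescentTamePotSupersingularTameLowerFibreAdjointBricksFiveResidueField
import Summits.BirchSwinnertonDyer.BirchSwinnertonDyer.Theorems.KatoDescentTamePotSupersingularTameLowerFibreAdjointBricksFiveSmuLift

/-!
# Bricks for the `GL₂(𝔽₅)`-lifting route (T5′), XV: the finite levels `A/𝔪ⁿ` of an abstract local pair
# `(A, 𝔪)` in instance-free currency

Continuation of files XIII–XIV (same namespace). Preparation of the passage to the limit (h) of ARM-P r07 S7
ADD-1 §C: for a commutative ring `A` and an ideal `𝔪` with `5 ∈ 𝔪`, `1 ∉ 𝔪`, every element off `𝔪` a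
unit (so `A` is local with maximal ideal `𝔪`, residue characteristic `5`, ANY residue field) and finite
quotients `A/𝔪ⁿ`, and a subgroup `G ≤ GL₂(A)` whose reduction modulo `𝔪` covers `GL₂(𝔽₅)` (stated
entrywise: `g ≡ q̃ (mod 𝔪)`), file XIII gives at every level `n` a conjugator `v ∈ GL₂(A/𝔪ⁿ)`, `v ≡ 1 (mod 𝔪)`,
with `v · w · v⁻¹ ∈ G mod 𝔪ⁿ` for every `w ∈ GL₂(A/𝔪ⁿ)` with INTEGER entries and `(det w)⁴ = 1` (= the image
of `S^μ(ℤ/5^{m+1})`, `5^{m+1} = char A/𝔪ⁿ`, file XIV). This file proves that level statement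
(`exists_levelGood`) and that reduction `A/𝔪^{n'} → A/𝔪ⁿ` preserves it (`levelGood_map_factor`, through the
`S^μ` lifting of file XIV) — the finite non-empty sets whose inverse limit file XVI takes.

Route-free, no definitions, nothing about elliptic curves or items 19618/19981 (open). Target T-S7r07-1.
-/

set_option linter.dupNamespace false

open Matrix

namespace Summit.BirchSwinnertonDyer.BirchSwinnertonDyer.Theorems.GL2F5AdjointBricks

section levels

universe u

variable {A : Type u} [CommRing A]

/-- The residue ring `A/𝔪` has characteristic `5` when `5 ∈ 𝔪 ∌ 1`. -/
theorem charP_quotient_five (𝔪 : Ideal A) (h5 : (5 : A) ∈ 𝔪) (h1 : (1 : A) ∉ 𝔪) : CharP (A ⧸ 𝔪) 5 := by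
  refine ⟨fun x => ⟨fun hx => ?_, fun hx => ?_⟩⟩
  · by_contra hnd
    have hcop : Nat.Coprime 5 x := (Nat.Prime.coprime_iff_not_dvd (by norm_num)).2 hnd
    obtain ⟨a, b, hab⟩ := Nat.isCoprime_iff_coprime.2 hcop
    rw [← map_natCast (Ideal.Quotient.mk 𝔪), Ideal.Quotient.eq_zero_iff_mem] at hx
    apply h1
    have e : (1 : A) = (a : A) * 5 + (b : A) * (x : A) := by exact_mod_cast congrArg (fun z : ℤ => (z : A)) hab.symm
    rw [e]
    exact 𝔪.add_mem (𝔪.mul_mem_left _ h5) (𝔪.mul_mem_left _ hx)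
  · obtain ⟨c, rfl⟩ := hx
    have h5' : ((5 : ℕ) : A ⧸ 𝔪) = 0 := by
      rw [Nat.cast_ofNat, ← map_ofNat (Ideal.Quotient.mk 𝔪) 5, Ideal.Quotient.eq_zero_iff_mem]; exact h5
    rw [Nat.cast_mul, h5', zero_mul]

/-- Every finite level `A/𝔪^{k+1}` has characteristic `5^{m+1}` for some `m` (`5 ∈ 𝔪 ∌ 1`). -/
theorem exists_charP_quotient_pow (𝔪 : Ideal A) (h5 : (5 : A) ∈ 𝔪) (h1 : (1 : A) ∉ 𝔪) (k : ℕ) :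
    ∃ m : ℕ, CharP (A ⧸ 𝔪 ^ (k + 1)) (5 ^ (m + 1)) := by
  have hdvd : ringChar (A ⧸ 𝔪 ^ (k + 1)) ∣ 5 ^ (k + 1) := by
    rw [← ringChar.spec, ← map_natCast (Ideal.Quotient.mk (𝔪 ^ (k + 1))), Ideal.Quotient.eq_zero_iff_mem,
      Nat.cast_pow]
    exact Ideal.pow_mem_pow h5 _
  obtain ⟨j, -, hj⟩ := (Nat.dvd_prime_pow (by norm_num : Nat.Prime 5)).1 hdvd
  have hj0 : j ≠ 0 := by
    rintro rfl
    rw [pow_zero] at hj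
    have h : ((1 : ℕ) : A ⧸ 𝔪 ^ (k + 1)) = 0 := by rw [ringChar.spec, hj]
    rw [← map_natCast (Ideal.Quotient.mk (𝔪 ^ (k + 1))), Ideal.Quotient.eq_zero_iff_mem, Nat.cast_one] at h
    exact h1 (Ideal.pow_le_self (Nat.succ_ne_zero k) h)
  obtain ⟨m, rfl⟩ : ∃ m, j = m + 1 := ⟨j - 1, by omega⟩
  exact ⟨m, ringChar.of_eq hj⟩

/-- **The level statement (instance-free).** For `(A, 𝔪)` as above with `A/𝔪^{k+1}` finite and
`G ≤ GL₂(A)` covering `GL₂(𝔽₅)` modulo `𝔪` entrywise, there is `v ∈ GL₂(A/𝔪^{k+1})`, `v ≡ 1 (mod 𝔪)`, such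
that `v · w · v⁻¹ ∈ G mod 𝔪^{k+1}` for every `w ∈ GL₂(A/𝔪^{k+1})` with integer entries and `(det w)⁴ = 1`
(file XIII at this level, read through file XIV). -/
theorem exists_levelGood (𝔪 : Ideal A) (h5 : (5 : A) ∈ 𝔪) (h1 : (1 : A) ∉ 𝔪)
    (hloc : ∀ a : A, a ∉ 𝔪 → IsUnit a) (k : ℕ) (hfin : Finite (A ⧸ 𝔪 ^ (k + 1)))
    (G : Subgroup (GL (Fin 2) A))
    (hres : ∀ q : GL (Fin 2) (ZMod 5), ∃ g ∈ G, ∀ i j, g.val i j - ((q.val i j).val : ℕ) ∈ 𝔪) :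
    ∃ v : GL (Fin 2) (A ⧸ 𝔪 ^ (k + 1)),
      (∀ i j, Ideal.Quotient.factor (Ideal.pow_le_self (Nat.succ_ne_zero k)) (v.val i j) =
        (1 : Matrix (Fin 2) (Fin 2) (A ⧸ 𝔪)) i j) ∧
      ∀ w : GL (Fin 2) (A ⧸ 𝔪 ^ (k + 1)),
        Matrix.det (w : Matrix (Fin 2) (Fin 2) (A ⧸ 𝔪 ^ (k + 1))) ^ 4 = 1 →
        (∀ i j, ∃ z : ℤ, w.val i j = z) →
          v * w * v⁻¹ ∈ G.map (Matrix.GeneralLinearGroup.map (Ideal.Quotient.mk (𝔪 ^ (k + 1)))) := by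
  classical
  haveI := hfin
  haveI : CharP (A ⧸ 𝔪) 5 := charP_quotient_five 𝔪 h5 h1
  obtain ⟨m, hm⟩ := exists_charP_quotient_pow 𝔪 h5 h1 k
  haveI := hm
  set π := Ideal.Quotient.mk (𝔪 ^ (k + 1)) with hπ
  set resk : A ⧸ 𝔪 ^ (k + 1) →+* A ⧸ 𝔪 := Ideal.Quotient.factor (Ideal.pow_le_self (Nat.succ_ne_zero k))
    with hresk
  have hreskπ : ∀ a, resk (π a) = Ideal.Quotient.mk 𝔪 a := fun a => Ideal.Quotient.factor_mk _ a
  set ι5 := ZMod.castHom (dvd_refl 5) (A ⧸ 𝔪) with hι5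
  have hι5val : ∀ c : ZMod 5, ι5 c = Ideal.Quotient.mk 𝔪 ((c.val : ℕ) : A) := by
    intro c; rw [map_natCast, ← map_natCast ι5 c.val, ZMod.natCast_zmod_val]
  -- units: residue a non-zero prime-field element
  have hlock : ∀ a : A ⧸ 𝔪 ^ (k + 1), (∃ c : ZMod 5, c ≠ 0 ∧ resk a = ι5 c) → IsUnit a := by
    rintro a ⟨c, hc0, hc⟩
    obtain ⟨a, rfl⟩ := Ideal.Quotient.mk_surjective a
    have ha : a ∉ 𝔪 := by
      intro ha
      rw [hreskπ, hι5val, Ideal.Quotient.mk_eq_mk_iff_sub_mem] at hc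
      have hcm : ((c.val : ℕ) : A) ∈ 𝔪 := by
        have := 𝔪.sub_mem ha hc; rwa [sub_sub_cancel] at this
      have hc5 : ((c.val : ℕ) : A ⧸ 𝔪) = 0 := by
        rw [← map_natCast (Ideal.Quotient.mk 𝔪), Ideal.Quotient.eq_zero_iff_mem]; exact hcm
      rw [CharP.cast_eq_zero_iff (A ⧸ 𝔪) 5] at hc5
      have hlt : c.val < 5 := c.val_lt
      have hv0 : c.val = 0 := Nat.eq_zero_of_dvd_of_lt hc5 hlt
      exact hc0 ((ZMod.val_eq_zero c).1 hv0)
    exact (hloc a ha).map π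
  -- the image of `G` at this level covers the image of `GL₂(𝔽₅)`
  set Gk := G.map (Matrix.GeneralLinearGroup.map (n := Fin 2) π) with hGk
  have hresk' : ∀ q : GL (Fin 2) (ZMod 5), ∃ h ∈ Gk, Matrix.GeneralLinearGroup.map resk h =
      Matrix.GeneralLinearGroup.map ι5 q := by
    intro q
    obtain ⟨g, hg, hgq⟩ := hres q
    refine ⟨Matrix.GeneralLinearGroup.map π g, Subgroup.mem_map_of_mem _ hg, ?_⟩
    apply Units.ext; ext i j
    simp only [Matrix.GeneralLinearGroup.map_apply]
    rw [hreskπ, hι5val, Ideal.Quotient.mk_eq_mk_iff_sub_mem]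
    exact hgq i j
  obtain ⟨v, hv1, hv⟩ :=
    exists_conj_smu_le_of_residual_GL2_charP (A ⧸ 𝔪 ^ (k + 1)) (A ⧸ 𝔪) resk hlock m Gk hresk'
  refine ⟨v, fun i j => ?_, fun w hw hwz => ?_⟩
  · have e := congrArg (fun x : GL (Fin 2) (A ⧸ 𝔪) => x.val i j) hv1
    simpa only [Matrix.GeneralLinearGroup.map_apply, Units.val_one] using e
  · obtain ⟨g, hg4, hgw⟩ := exists_smu_castHom_eq_of_intCast m w hwz hw
    rw [← hgw]
    exact hv g hg4

/-- **Reduction preserves the level statement.** If `v ∈ GL₂(A/𝔪^{k'+1})` is good at level `k'+1` then its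
reduction is good at level `k+1 ≤ k'+1`: integer-entry `det⁴ = 1` elements lift along
`A/𝔪^{k'+1} → A/𝔪^{k+1}` (file XIV's `S^μ` lifting between the two characteristics). -/
theorem levelGood_map_factor (𝔪 : Ideal A) (h5 : (5 : A) ∈ 𝔪) (h1 : (1 : A) ∉ 𝔪) (k k' : ℕ)
    (hkk' : k ≤ k') (G : Subgroup (GL (Fin 2) A)) (v : GL (Fin 2) (A ⧸ 𝔪 ^ (k' + 1)))
    (hv1 : ∀ i j, Ideal.Quotient.factor (Ideal.pow_le_self (Nat.succ_ne_zero k')) (v.val i j) =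
        (1 : Matrix (Fin 2) (Fin 2) (A ⧸ 𝔪)) i j)
    (hv : ∀ w : GL (Fin 2) (A ⧸ 𝔪 ^ (k' + 1)),
        Matrix.det (w : Matrix (Fin 2) (Fin 2) (A ⧸ 𝔪 ^ (k' + 1))) ^ 4 = 1 →
        (∀ i j, ∃ z : ℤ, w.val i j = z) →
          v * w * v⁻¹ ∈ G.map (Matrix.GeneralLinearGroup.map (Ideal.Quotient.mk (𝔪 ^ (k' + 1))))) :
    (∀ i j, Ideal.Quotient.factor (Ideal.pow_le_self (Nat.succ_ne_zero k))
        ((Matrix.GeneralLinearGroup.map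
          (Ideal.Quotient.factor (Ideal.pow_le_pow_right (Nat.succ_le_succ hkk'))) v).val i j) =
        (1 : Matrix (Fin 2) (Fin 2) (A ⧸ 𝔪)) i j) ∧
      ∀ w : GL (Fin 2) (A ⧸ 𝔪 ^ (k + 1)),
        Matrix.det (w : Matrix (Fin 2) (Fin 2) (A ⧸ 𝔪 ^ (k + 1))) ^ 4 = 1 →
        (∀ i j, ∃ z : ℤ, w.val i j = z) →
          Matrix.GeneralLinearGroup.map
              (Ideal.Quotient.factor (Ideal.pow_le_pow_right (Nat.succ_le_succ hkk'))) v * w *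
            (Matrix.GeneralLinearGroup.map
              (Ideal.Quotient.factor (Ideal.pow_le_pow_right (Nat.succ_le_succ hkk'))) v)⁻¹ ∈
            G.map (Matrix.GeneralLinearGroup.map (Ideal.Quotient.mk (𝔪 ^ (k + 1)))) := by
  classical
  obtain ⟨m, hm⟩ := exists_charP_quotient_pow 𝔪 h5 h1 k
  obtain ⟨m', hm'⟩ := exists_charP_quotient_pow 𝔪 h5 h1 k'
  haveI := hm
  haveI := hm'
  set red : A ⧸ 𝔪 ^ (k' + 1) →+* A ⧸ 𝔪 ^ (k + 1) :=
    Ideal.Quotient.factor (Ideal.pow_le_pow_right (Nat.succ_le_succ hkk')) with hred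
  set redG := Matrix.GeneralLinearGroup.map (n := Fin 2) red with hredG
  have hredmk : ∀ a, red (Ideal.Quotient.mk (𝔪 ^ (k' + 1)) a) = Ideal.Quotient.mk (𝔪 ^ (k + 1)) a :=
    fun a => Ideal.Quotient.factor_mk _ a
  -- the two characteristics are comparable
  have hmm' : m + 1 ≤ m' + 1 := by
    have h0 : ((5 ^ (m' + 1) : ℕ) : A ⧸ 𝔪 ^ (k + 1)) = 0 := by
      have h := (CharP.cast_eq_zero_iff (A ⧸ 𝔪 ^ (k' + 1)) (5 ^ (m' + 1)) (5 ^ (m' + 1))).2 dvd_rfl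
      have h' := congrArg red h
      rwa [map_natCast, map_zero] at h'
    rw [CharP.cast_eq_zero_iff (A ⧸ 𝔪 ^ (k + 1)) (5 ^ (m + 1))] at h0
    exact (Nat.pow_dvd_pow_iff_le_right (by norm_num)).1 h0
  constructor
  · intro i j
    rw [Matrix.GeneralLinearGroup.map_apply, ← hv1 i j]
    obtain ⟨a, ha⟩ := Ideal.Quotient.mk_surjective (v.val i j)
    rw [← ha, hredmk, Ideal.Quotient.factor_mk, Ideal.Quotient.factor_mk]
  · intro w hw hwz
    -- `w` is the image of `g ∈ S^μ(ℤ/5^{m+1})`; lift `g` to `S^μ(ℤ/5^{m'+1})` and map to level `k'+1`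
    obtain ⟨g, hg4, hgw⟩ := exists_smu_castHom_eq_of_intCast m w hwz hw
    obtain ⟨g', hg'4, hg'g⟩ := exists_smu_map_eq_of_le (m' + 1) (m + 1) (Nat.succ_pos m) hmm' g hg4
    set w' := Matrix.GeneralLinearGroup.map (ZMod.castHom (dvd_refl (5 ^ (m' + 1))) (A ⧸ 𝔪 ^ (k' + 1))) g'
      with hw'
    obtain ⟨hw'z, hw'4⟩ := intCast_of_smu_castHom (R := A ⧸ 𝔪 ^ (k' + 1)) m' g' hg'4
    have hmem := hv w' hw'4 hw'z
    -- reduce to level `k+1`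
    have hredw' : redG w' = w := by
      rw [← hgw, ← hg'g, hw']
      have hc : red.comp (ZMod.castHom (dvd_refl (5 ^ (m' + 1))) (A ⧸ 𝔪 ^ (k' + 1))) =
          (ZMod.castHom (dvd_refl (5 ^ (m + 1))) (A ⧸ 𝔪 ^ (k + 1))).comp
            (ZMod.castHom (pow_dvd_pow 5 hmm') (ZMod (5 ^ (m + 1)))) := Subsingleton.elim _ _
      have h := congrArg (fun φ => Matrix.GeneralLinearGroup.map (n := Fin 2) φ g') hc
      simp only [Matrix.GeneralLinearGroup.map_comp, MonoidHom.comp_apply] at h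
      exact h
    have hredGmk : redG.comp (Matrix.GeneralLinearGroup.map (n := Fin 2) (Ideal.Quotient.mk (𝔪 ^ (k' + 1)))) =
        Matrix.GeneralLinearGroup.map (n := Fin 2) (Ideal.Quotient.mk (𝔪 ^ (k + 1))) := by
      rw [hredG, ← Matrix.GeneralLinearGroup.map_comp, Ideal.Quotient.factor_comp_mk]
    have h2 := Subgroup.mem_map_of_mem redG hmem
    rw [Subgroup.map_map, hredGmk, map_mul, map_mul, map_inv, hredw'] at h2
    exact h2

end levels

end Summit.BirchSwinnertonDyer.BirchSwinnertonDyer.Theorems.GL2F5AdjointBricks
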